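import Summits.PneNP.PneNP.Theorems.ChebyshevTracialDesignGammaDirectionSecondMomentBudget
import Summits.PneNP.PneNP.Theorems.ChebyshevTracialDesignGammaDirectionFirstMoment
import Summits.PneNP.PneNP.Theorems.ChebyshevTracialDesignGammaDirectionSecondMomentRelativeFirst
import HarnessLib

/-!
# Cell pnp-psdrank, route `ChebyshevTracialDesign`: the level-`1` shell atoms of the relative form of the centred second moment's
# level-smoothness sum (crux `TracialDecayExp20`, stmt-PneNP-19878)

Brick 139c (prover g28; MEMO-30 rev 3 §3b/§4). The passage from brick 138's budget form to hypothesis (hA) of brick 130 (`≤ ε_A·A^m_1(x)`) needs,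
besides the pure real arithmetic of `…SecondMomentRelativeOrders/First`, five facts about the shells of a perfect matching `M` on `Fin n` with a
block `H` of type `(a,b,d)` at the cut `2r+7` (written `2r+1+6` as brick 138 prints it) and base level `1`:

* §1 **`pairDensity_le_half`**: `(|vAA||vDD| + Σ_{p∈vBH}|vBN∖{πp}|)/(n(n−2)) ≤ ½` (`|vAA| = 2a`, `|vDD| = 2d`, `|vBH| = |vBN| = b`, `n = 2(a+b+d)`, `b ≥ 3`).
* §2 **`firstFactorial_eq` / `secondFactorial_eq`**: the level-`1` cases of the three-law form (Literature `weightedSection_eq_laws`):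
  `F¹_1(x) = E_1[1_{X=x} n_A] = ((2r+6)/n)·G₁(0)`, `F²_1(x) = E_1[1_x n_A(n_A−1)] = ((2r+6)(2r+4)/(n(n−2)))·G₂(0)`, `G₁(0) = Σ_{v∈reps vAA} law_{[n]∖e_v}(2r+5,1;x−2)`,
  `G₂(0) = Σ_{v≠w} law_{[n]∖e_v∖e_w}(2r+3,1;x−4)`; and the pointwise bounds **`firstFactorial_le`** (`F¹ ≤ a·law`), **`secondFactorial_le`**
  (`F² ≤ a²·law`), `firstFactorial_nonneg`, `secondFactorial_nonneg` (`0 ≤ n_A ≤ a`).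
* §3 **`firstFactorial_eq_centre_mul_law`**: the centring `B^m_1(x) = 0` (brick 130's `hcentre`) says `F¹_1(x) = m·law_1(x)`; hence `0 ≤ m ≤ a` once
  `law_1(x) > 0` (**`centre_nonneg`, `centre_le`**).
* §4 **`law_three_le`** (`law_3 ≤ (1+2Γq)·law_1 + (8/3)τ` from the `k = 1` budget of `G₀`) and **`abs_centredFirst_three_le`**: brick 133 at `k = 1` +
  the centring + the `k = 1` budgets of `G₀, G₁` (Lq shape `Γq·G(0) + κ(4/3)τ`) + §2 ⇒ `|B^m_3(x)| ≤ a·law_1·(4Γq + (2+4Γq)/(2r+6)) + (16a/3)τ`.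
WHAT THIS FILE DOES NOT DO: the budgets themselves, (V), the assembly (brick 139 `…SecondMomentRelative`), anything on `TracialDecayExp20` itself,
psd rank of P_PM(K_n), or P vs NP. [cite: Rothvoss2017, §2 (PDF p. 6)] [cite: Boole2009, Ch. II Art. 10 Ex. 3 eq. (8)] [cite: RollinRoss2010, §4.1 Thm 4.2]
Stature: support/instrument (kernel lane, no defs, axioms standard). Supports stmt-PneNP-19878.
-/

set_option linter.dupNamespace false -- `Summit.PneNP.PneNP.…`: summit = sub-problem (D-0017)

noncomputable section

namespace Summit.PneNP.PneNP.Theorems.ChebyshevTracialDesignGammaDirectionSecondMomentRelativeAtoms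

open Finset Polynomial Literature.Barriers.PneNP Literature.Combinatorics.Optimization
open Literature.Combinatorics.Optimization.ShellStep
open Summit.PneNP.PneNP.Theorems.ChebyshevTracialDesignShellOperatorForm (shell_partner_nonempty)
open Summit.PneNP.PneNP.Theorems.ChebyshevTracialDesignGammaDirectionFirstMoment (abs_fwdDiff_iter_centredFirst_le)
open Summit.PneNP.PneNP.Theorems.ChebyshevTracialDesignGammaDirectionSecondMomentRelativeFirst (b3_bound_of natCast_mul_sub_one_le_sq)

variable {n : ℕ}

/-! ### §1 The pair density -/

/-- **The pair density is at most `½`**: for a perfect matching on `Fin n` and a block of type `(a,b,d)` with `n = 2(a+b+d)` and `b ≥ 3`,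
`(|vAA|·|vDD| + Σ_{p∈vBH} |vBN ∖ {πp}|)/(n(n−2)) ≤ ½` (`|vAA| = 2a`, `|vDD| = 2d`, `|vBH| = |vBN| = b`, and `2(4ad + b²) ≤ 2N₀(2N₀−2)`).
[cite: Rothvoss2017, §2 (PDF p. 6)] -/
theorem pairDensity_le_half (M : PMatch n) (H : Finset (Fin n)) {a b d N₀ : ℕ}
    (ha : (reps M.2.partner (vAA M.2.partner univ H)).card = a)
    (hb : (reps M.2.partner (vBH M.2.partner univ H ∪ vBN M.2.partner univ H)).card = b)
    (hd : (reps M.2.partner (vDD M.2.partner univ H)).card = d) (hN : a + b + d = N₀) (hn : n = 2 * N₀) (hb3 : 3 ≤ b) :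
    (((vAA M.2.partner univ H).card : ℝ) * (vDD M.2.partner univ H).card +
        ∑ p ∈ vBH M.2.partner univ H, (((vBN M.2.partner univ H).erase (M.2.partner p)).card : ℝ)) /
      ((n : ℝ) * ((n : ℝ) - 2)) ≤ 1 / 2 := by
  set π := M.2.partner with hπdef
  have hπ : ∀ v, π (π v) = v := partner_partner M
  have hπ' : ∀ v, π v ≠ v := partner_ne M
  have hst : ∀ v ∈ (univ : Finset (Fin n)), π v ∈ univ := fun v _ => mem_univ _
  have hA := two_mul_card_reps hπ hπ' (vAA_stable hπ univ H hst)
  have hD := two_mul_card_reps hπ hπ' (vDD_stable hπ univ H hst)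
  have hB := two_mul_card_reps hπ hπ' (vB_stable hπ univ H hst)
  have hdisj : Disjoint (vBH π univ H) (vBN π univ H) :=
    disjoint_left.2 fun v hv hv' => (mem_vBN.1 hv').2.1 (mem_vBH.1 hv).2.1
  rw [card_union_of_disjoint hdisj, ← card_vBH_eq_card_vBN hπ hst H, hb] at hB
  rw [ha] at hA
  rw [hd] at hD
  have hBH : (vBH π univ H).card = b := by omega
  have hBN : (vBN π univ H).card = b := by rw [← card_vBH_eq_card_vBN hπ hst H, hBH]
  have hsum : ∑ p ∈ vBH π univ H, (((vBN π univ H).erase (π p)).card : ℝ) ≤ (b : ℝ) * b := by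
    calc ∑ p ∈ vBH π univ H, (((vBN π univ H).erase (π p)).card : ℝ) ≤ ∑ p ∈ vBH π univ H, ((vBN π univ H).card : ℝ) :=
          sum_le_sum fun p _ => by exact_mod_cast card_erase_le
      _ = (b : ℝ) * b := by rw [sum_const, nsmul_eq_mul, hBH, hBN]
  have hAA : ((vAA π univ H).card : ℝ) = 2 * a := by exact_mod_cast hA.symm
  have hDD : ((vDD π univ H).card : ℝ) = 2 * d := by exact_mod_cast hD.symm
  have hnR : (n : ℝ) = 2 * ((a : ℝ) + b + d) := by
    have : (n : ℝ) = 2 * (N₀ : ℝ) := by exact_mod_cast hn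
    rw [this, ← hN]; push_cast; ring
  have hb3R : (3 : ℝ) ≤ b := by exact_mod_cast hb3
  have ha0 : (0 : ℝ) ≤ a := Nat.cast_nonneg a
  have hd0 : (0 : ℝ) ≤ d := Nat.cast_nonneg d
  have hb0 : (0 : ℝ) ≤ b := Nat.cast_nonneg b
  have hden : 0 < (n : ℝ) * ((n : ℝ) - 2) := by
    rw [hnR]; exact mul_pos (by linarith) (by linarith)
  rw [div_le_iff₀ hden, hAA, hDD, hnR]
  nlinarith [hsum, sq_nonneg (2 * (a : ℝ) - 1), sq_nonneg (2 * (d : ℝ) - 1), mul_nonneg ha0 hd0, mul_nonneg ha0 hb0,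
    mul_nonneg hd0 hb0]

/-! ### §2 The factorial sections at level `1` -/

/-- **`F¹_1(x) = ((2r+6)/n)·G₁(0)`** — the weight `(0,1,0)` case of Literature `weightedSection_eq_laws` at the cut `2r+7`, level `1`.
[cite: Rothvoss2017, §2 (PDF p. 6)] -/
theorem firstFactorial_eq (M : PMatch n) (H : Finset (Fin n)) {r : ℕ} (hrn : 2 * r + 1 + 6 + 1 ≤ n) (x : ℤ) :
    (∑ U ∈ ((shellIn M.2.partner univ (2 * r + 1 + 6) 1).filter fun U => ((U ∩ H).card : ℤ) = x),
        ((((reps M.2.partner (vAA M.2.partner univ H)).filter fun v => v ∈ U ∧ M.2.partner v ∈ U).card : ℕ) : ℝ)) /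
        ((shellIn M.2.partner univ (2 * r + 1 + 6) 1).card : ℝ) =
      (2 * (r : ℝ) + 6) / (n : ℝ) *
        ∑ v ∈ reps M.2.partner (vAA M.2.partner univ H), shellLaw M.2.partner (univ \ {v, M.2.partner v}) H (2 * r + 3 + 2) 1 (x - 2) := by
  set π := M.2.partner with hπdef
  have hπ : ∀ v, π (π v) = v := partner_partner M
  have hπ' : ∀ v, π v ≠ v := partner_ne M
  have hst : ∀ v ∈ (univ : Finset (Fin n)), π v ∈ univ := fun v _ => mem_univ _
  have hncard : ((univ : Finset (Fin n)).card : ℝ) = n := by rw [card_univ, Fintype.card_fin]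
  have hne : (shellIn π univ (2 * r + 3 + 4) 1).Nonempty := by
    rw [shellIn_univ]; exact shell_partner_nonempty M ⟨r + 3, by ring⟩ ⟨0, by ring⟩ (by omega) (by omega)
  have h := weightedSection_eq_laws hπ hπ' hst H hne 0 1 0 x
  rw [show 2 * r + 3 + 4 = 2 * r + 1 + 6 by ring, hncard] at h
  have e : (∑ U ∈ ((shellIn π univ (2 * r + 1 + 6) 1).filter fun U => ((U ∩ H).card : ℤ) = x),
        ((((reps π (vAA π univ H)).filter fun v => v ∈ U ∧ π v ∈ U).card : ℕ) : ℝ)) =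
      ∑ U ∈ ((shellIn π univ (2 * r + 1 + 6) 1).filter fun U => ((U ∩ H).card : ℤ) = x),
        (0 * (((((reps π (vAA π univ H)).filter fun v => v ∈ U ∧ π v ∈ U).card : ℕ) : ℝ) *
            (((((reps π (vAA π univ H)).filter fun v => v ∈ U ∧ π v ∈ U).card : ℕ) : ℝ) - 1)) +
          1 * ((((reps π (vAA π univ H)).filter fun v => v ∈ U ∧ π v ∈ U).card : ℕ) : ℝ) + 0) :=
    sum_congr rfl fun U _ => by ring
  rw [e, h]
  push_cast
  ring

/-- **`F²_1(x) = ((2r+6)(2r+4)/(n(n−2)))·G₂(0)`** — the weight `(1,0,0)` case of `weightedSection_eq_laws` at the cut `2r+7`, level `1`.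
[cite: Rothvoss2017, §2 (PDF p. 6)] -/
theorem secondFactorial_eq (M : PMatch n) (H : Finset (Fin n)) {r : ℕ} (hrn : 2 * r + 1 + 6 + 1 ≤ n) (x : ℤ) :
    (∑ U ∈ ((shellIn M.2.partner univ (2 * r + 1 + 6) 1).filter fun U => ((U ∩ H).card : ℤ) = x),
        (((((reps M.2.partner (vAA M.2.partner univ H)).filter fun v => v ∈ U ∧ M.2.partner v ∈ U).card : ℕ) : ℝ) *
          (((((reps M.2.partner (vAA M.2.partner univ H)).filter fun v => v ∈ U ∧ M.2.partner v ∈ U).card : ℕ) : ℝ) - 1))) /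
        ((shellIn M.2.partner univ (2 * r + 1 + 6) 1).card : ℝ) =
      (2 * (r : ℝ) + 6) * (2 * (r : ℝ) + 4) / ((n : ℝ) * ((n : ℝ) - 2)) *
        ∑ v ∈ reps M.2.partner (vAA M.2.partner univ H), ∑ w ∈ (reps M.2.partner (vAA M.2.partner univ H)).erase v,
          shellLaw M.2.partner (del2 M.2.partner univ v w) H (2 * r + 3) 1 (x - 4) := by
  set π := M.2.partner with hπdef
  have hπ : ∀ v, π (π v) = v := partner_partner M
  have hπ' : ∀ v, π v ≠ v := partner_ne M
  have hst : ∀ v ∈ (univ : Finset (Fin n)), π v ∈ univ := fun v _ => mem_univ _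
  have hncard : ((univ : Finset (Fin n)).card : ℝ) = n := by rw [card_univ, Fintype.card_fin]
  have hne : (shellIn π univ (2 * r + 3 + 4) 1).Nonempty := by
    rw [shellIn_univ]; exact shell_partner_nonempty M ⟨r + 3, by ring⟩ ⟨0, by ring⟩ (by omega) (by omega)
  have h := weightedSection_eq_laws hπ hπ' hst H hne 1 0 0 x
  rw [show 2 * r + 3 + 4 = 2 * r + 1 + 6 by ring, hncard] at h
  have e : (∑ U ∈ ((shellIn π univ (2 * r + 1 + 6) 1).filter fun U => ((U ∩ H).card : ℤ) = x),
        (((((reps π (vAA π univ H)).filter fun v => v ∈ U ∧ π v ∈ U).card : ℕ) : ℝ) *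
          (((((reps π (vAA π univ H)).filter fun v => v ∈ U ∧ π v ∈ U).card : ℕ) : ℝ) - 1))) =
      ∑ U ∈ ((shellIn π univ (2 * r + 1 + 6) 1).filter fun U => ((U ∩ H).card : ℤ) = x),
        (1 * (((((reps π (vAA π univ H)).filter fun v => v ∈ U ∧ π v ∈ U).card : ℕ) : ℝ) *
            (((((reps π (vAA π univ H)).filter fun v => v ∈ U ∧ π v ∈ U).card : ℕ) : ℝ) - 1)) +
          0 * ((((reps π (vAA π univ H)).filter fun v => v ∈ U ∧ π v ∈ U).card : ℕ) : ℝ) + 0) :=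
    sum_congr rfl fun U _ => by ring
  rw [e, h]
  push_cast
  ring

/-- **`0 ≤ F¹_c(x)`**. [cite: Rothvoss2017, §2 (PDF p. 6)] -/
theorem firstFactorial_nonneg (M : PMatch n) (H : Finset (Fin n)) (t c : ℕ) (x : ℤ) :
    0 ≤ (∑ U ∈ ((shellIn M.2.partner univ t c).filter fun U => ((U ∩ H).card : ℤ) = x),
        ((((reps M.2.partner (vAA M.2.partner univ H)).filter fun v => v ∈ U ∧ M.2.partner v ∈ U).card : ℕ) : ℝ)) /
        ((shellIn M.2.partner univ t c).card : ℝ) :=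
  div_nonneg (sum_nonneg fun _ _ => Nat.cast_nonneg _) (Nat.cast_nonneg _)

/-- **`F¹_c(x) ≤ a·law_c(x)`** (`n_A ≤ a` pointwise). [cite: Rothvoss2017, §2 (PDF p. 6)] -/
theorem firstFactorial_le (M : PMatch n) (H : Finset (Fin n)) {a : ℕ} (ha : (reps M.2.partner (vAA M.2.partner univ H)).card = a)
    (t c : ℕ) (x : ℤ) :
    (∑ U ∈ ((shellIn M.2.partner univ t c).filter fun U => ((U ∩ H).card : ℤ) = x),
        ((((reps M.2.partner (vAA M.2.partner univ H)).filter fun v => v ∈ U ∧ M.2.partner v ∈ U).card : ℕ) : ℝ)) /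
        ((shellIn M.2.partner univ t c).card : ℝ) ≤
      (a : ℝ) * shellLaw M.2.partner univ H t c x := by
  have hpt : ∀ U ∈ ((shellIn M.2.partner univ t c).filter fun U => ((U ∩ H).card : ℤ) = x),
      ((((reps M.2.partner (vAA M.2.partner univ H)).filter fun v => v ∈ U ∧ M.2.partner v ∈ U).card : ℕ) : ℝ) ≤ (a : ℝ) := by
    intro U _
    exact_mod_cast (card_filter_le _ _).trans ha.le
  rw [shellLaw, shellCount]
  calc _ ≤ (∑ U ∈ ((shellIn M.2.partner univ t c).filter fun U => ((U ∩ H).card : ℤ) = x), (a : ℝ)) /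
        ((shellIn M.2.partner univ t c).card : ℝ) := div_le_div_of_nonneg_right (sum_le_sum hpt) (Nat.cast_nonneg _)
    _ = _ := by rw [sum_const, nsmul_eq_mul]; ring

/-- **`0 ≤ F²_c(x)`** (`n_A(n_A−1) ≥ 0` for a natural number `n_A`). [cite: Rothvoss2017, §2 (PDF p. 6)] -/
theorem secondFactorial_nonneg (M : PMatch n) (H : Finset (Fin n)) (t c : ℕ) (x : ℤ) :
    0 ≤ (∑ U ∈ ((shellIn M.2.partner univ t c).filter fun U => ((U ∩ H).card : ℤ) = x),
        (((((reps M.2.partner (vAA M.2.partner univ H)).filter fun v => v ∈ U ∧ M.2.partner v ∈ U).card : ℕ) : ℝ) *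
          (((((reps M.2.partner (vAA M.2.partner univ H)).filter fun v => v ∈ U ∧ M.2.partner v ∈ U).card : ℕ) : ℝ) - 1))) /
        ((shellIn M.2.partner univ t c).card : ℝ) := by
  refine div_nonneg (sum_nonneg fun U _ => ?_) (Nat.cast_nonneg _)
  rcases Nat.eq_zero_or_pos (((reps M.2.partner (vAA M.2.partner univ H)).filter fun v => v ∈ U ∧ M.2.partner v ∈ U).card) with h | h
  · rw [h]; simp
  · have h1 : (1 : ℝ) ≤ ((((reps M.2.partner (vAA M.2.partner univ H)).filter fun v => v ∈ U ∧ M.2.partner v ∈ U).card : ℕ) : ℝ) := by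
      exact_mod_cast h
    exact mul_nonneg (by linarith) (by linarith)

/-- **`F²_c(x) ≤ a²·law_c(x)`** (`n_A(n_A−1) ≤ a²` pointwise). [cite: Rothvoss2017, §2 (PDF p. 6)] -/
theorem secondFactorial_le (M : PMatch n) (H : Finset (Fin n)) {a : ℕ} (ha : (reps M.2.partner (vAA M.2.partner univ H)).card = a)
    (t c : ℕ) (x : ℤ) :
    (∑ U ∈ ((shellIn M.2.partner univ t c).filter fun U => ((U ∩ H).card : ℤ) = x),
        (((((reps M.2.partner (vAA M.2.partner univ H)).filter fun v => v ∈ U ∧ M.2.partner v ∈ U).card : ℕ) : ℝ) *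
          (((((reps M.2.partner (vAA M.2.partner univ H)).filter fun v => v ∈ U ∧ M.2.partner v ∈ U).card : ℕ) : ℝ) - 1))) /
        ((shellIn M.2.partner univ t c).card : ℝ) ≤
      (a : ℝ) ^ 2 * shellLaw M.2.partner univ H t c x := by
  have hpt : ∀ U ∈ ((shellIn M.2.partner univ t c).filter fun U => ((U ∩ H).card : ℤ) = x),
      ((((reps M.2.partner (vAA M.2.partner univ H)).filter fun v => v ∈ U ∧ M.2.partner v ∈ U).card : ℕ) : ℝ) *
        (((((reps M.2.partner (vAA M.2.partner univ H)).filter fun v => v ∈ U ∧ M.2.partner v ∈ U).card : ℕ) : ℝ) - 1) ≤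
        (a : ℝ) ^ 2 := by
    intro U _
    exact ChebyshevTracialDesignGammaDirectionSecondMomentRelativeFirst.natCast_mul_sub_one_le_sq
      ((card_filter_le _ _).trans ha.le)
  rw [shellLaw, shellCount]
  calc _ ≤ (∑ U ∈ ((shellIn M.2.partner univ t c).filter fun U => ((U ∩ H).card : ℤ) = x), (a : ℝ) ^ 2) /
        ((shellIn M.2.partner univ t c).card : ℝ) := div_le_div_of_nonneg_right (sum_le_sum hpt) (Nat.cast_nonneg _)
    _ = _ := by rw [sum_const, nsmul_eq_mul]; ring

/-! ### §3 The centring -/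

/-- **The centring says `F¹_1(x) = m·law_1(x)`**: if `B^m_1(x) = (Σ_{U : X=x}(n_A − m))/|Shell_1| = 0` (brick 130's `hcentre`, nonempty shell),
then `F¹_1(x) = m·law_1(x)`. [cite: Rothvoss2017, §2 (PDF p. 6)] -/
theorem firstFactorial_eq_centre_mul_law (M : PMatch n) (H : Finset (Fin n)) (t : ℕ) (x : ℕ) (m : ℝ)
    (hne : (shell M.2.partner t 1).Nonempty)
    (hcentre : ((∑ U ∈ ((shell M.2.partner t 1).filter fun U => ((U ∩ H).card : ℤ) = x),
          (((((reps M.2.partner (vAA M.2.partner univ H)).filter fun v => v ∈ U ∧ M.2.partner v ∈ U).card : ℕ) : ℝ) - m)) /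
          ((shell M.2.partner t 1).card : ℝ)) = 0) :
    (∑ U ∈ ((shellIn M.2.partner univ t 1).filter fun U => ((U ∩ H).card : ℤ) = x),
        ((((reps M.2.partner (vAA M.2.partner univ H)).filter fun v => v ∈ U ∧ M.2.partner v ∈ U).card : ℕ) : ℝ)) /
        ((shellIn M.2.partner univ t 1).card : ℝ) =
      m * shellLaw M.2.partner univ H t 1 x := by
  rw [← shellIn_univ] at hne hcentre
  have hc : (0 : ℝ) < (shellIn M.2.partner univ t 1).card := by exact_mod_cast hne.card_pos
  rw [div_eq_zero_iff, or_iff_left hc.ne'] at hcentre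
  rw [sum_sub_distrib, sum_const, nsmul_eq_mul, sub_eq_zero] at hcentre
  rw [hcentre, shellLaw, shellCount]
  ring

/-- `0 ≤ m` from the centring and `law_1(x) > 0`. [cite: Rothvoss2017, §2 (PDF p. 6)] -/
theorem centre_nonneg (M : PMatch n) (H : Finset (Fin n)) (t : ℕ) (x : ℕ) (m : ℝ)
    (hne : (shell M.2.partner t 1).Nonempty)
    (hcentre : ((∑ U ∈ ((shell M.2.partner t 1).filter fun U => ((U ∩ H).card : ℤ) = x),
          (((((reps M.2.partner (vAA M.2.partner univ H)).filter fun v => v ∈ U ∧ M.2.partner v ∈ U).card : ℕ) : ℝ) - m)) /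
          ((shell M.2.partner t 1).card : ℝ)) = 0)
    (hlaw : 0 < shellLaw M.2.partner univ H t 1 x) : 0 ≤ m := by
  have h := firstFactorial_eq_centre_mul_law M H t x m hne hcentre
  have h0 := firstFactorial_nonneg M H t 1 (x : ℤ)
  rw [h] at h0
  exact nonneg_of_mul_nonneg_left h0 hlaw

/-- `m ≤ a` from the centring and `law_1(x) > 0`. [cite: Rothvoss2017, §2 (PDF p. 6)] -/
theorem centre_le (M : PMatch n) (H : Finset (Fin n)) {a : ℕ} (ha : (reps M.2.partner (vAA M.2.partner univ H)).card = a)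
    (t : ℕ) (x : ℕ) (m : ℝ) (hne : (shell M.2.partner t 1).Nonempty)
    (hcentre : ((∑ U ∈ ((shell M.2.partner t 1).filter fun U => ((U ∩ H).card : ℤ) = x),
          (((((reps M.2.partner (vAA M.2.partner univ H)).filter fun v => v ∈ U ∧ M.2.partner v ∈ U).card : ℕ) : ℝ) - m)) /
          ((shell M.2.partner t 1).card : ℝ)) = 0)
    (hlaw : 0 < shellLaw M.2.partner univ H t 1 x) : m ≤ a := by
  have h := firstFactorial_eq_centre_mul_law M H t x m hne hcentre
  have h1 := firstFactorial_le M H ha t 1 (x : ℤ)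
  rw [h] at h1
  exact le_of_mul_le_mul_right h1 hlaw

/-! ### §4 The `law_3` and `|B^m_3|` atoms from the `k = 1` budgets -/

/-- **`law_3(x) ≤ (1+2Γq)·law_1(x) + (8/3)τ`** from the `k = 1` budget of `G₀` in Lq shape. [cite: RollinRoss2010, §4.1 Thm 4.2] -/
theorem law_three_le (M : PMatch n) (H : Finset (Fin n)) (r : ℕ) (x : ℕ) {Γ q τ : ℝ}
    (h₀ : (((2 * 1).choose 1 : ℕ) : ℝ) / (4 : ℝ) ^ 1 *
        |(fwdDiff (1 : ℕ))^[1] (fun j : ℕ => shellLaw M.2.partner univ H (2 * r + 1 + 6) (2 * j + 1) x) 0| ≤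
      Γ * q ^ 1 * shellLaw M.2.partner univ H (2 * r + 1 + 6) 1 x + (4 / 3 : ℝ) ^ 1 * τ) :
    shellLaw M.2.partner univ H (2 * r + 1 + 6) (1 + 2) x ≤
      (1 + 2 * Γ * q) * shellLaw M.2.partner univ H (2 * r + 1 + 6) 1 x + 8 / 3 * τ := by
  have e : (((2 * 1).choose 1 : ℕ) : ℝ) / (4 : ℝ) ^ 1 = 1 / 2 := by norm_num
  rw [e, Function.iterate_one, fwdDiff] at h₀
  simp only [zero_add, mul_one, mul_zero, pow_one, Nat.reduceAdd] at h₀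
  have h1 := (abs_le.1 (show |shellLaw M.2.partner univ H (2 * r + 1 + 6) 3 ↑x - shellLaw M.2.partner univ H (2 * r + 1 + 6) 1 ↑x| ≤
    2 * (Γ * q * shellLaw M.2.partner univ H (2 * r + 1 + 6) 1 ↑x + 4 / 3 * τ) by linarith)).2
  show shellLaw M.2.partner univ H (2 * r + 1 + 6) 3 x ≤ _
  linarith

/-- **THE `|B^m_3|` ATOM**: with the centring `B^m_1(x) = 0`, `0 ≤ m ≤ a`, `2r+10 ≤ n`, and the `k = 1` budgets of `G₀` (on `[n]`) and `G₁`
(one-pinned family) in Lq shape, `|B^m_3(x)| ≤ a·law_1(x)·(4Γq + (2+4Γq)/(2r+6)) + (16a/3)τ` (brick 133 at `k = 1`, `F¹_1 = ((2r+6)/n)G₁(0) ≤ a·law_1`,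
`…RelativeFirst.b3_bound_of`). [cite: Boole2009, Ch. II Art. 10 Ex. 3 eq. (8)] [cite: Rothvoss2017, §2 (PDF p. 6)] -/
theorem abs_centredFirst_three_le (M : PMatch n) (H : Finset (Fin n)) {a : ℕ}
    (ha : (reps M.2.partner (vAA M.2.partner univ H)).card = a) {r : ℕ} (hrn : 2 * r + 10 ≤ n) (x : ℕ) {m : ℝ}
    (hm0 : 0 ≤ m) (hma : m ≤ a)
    (hcentre : ((∑ U ∈ ((shell M.2.partner (2 * r + 1 + 6) 1).filter fun U => ((U ∩ H).card : ℤ) = x),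
          (((((reps M.2.partner (vAA M.2.partner univ H)).filter fun v => v ∈ U ∧ M.2.partner v ∈ U).card : ℕ) : ℝ) - m)) /
          ((shell M.2.partner (2 * r + 1 + 6) 1).card : ℝ)) = 0)
    {Γ q τ : ℝ} (hΓ : 0 ≤ Γ) (hq : 0 ≤ q) (hτ : 0 ≤ τ)
    (h₀ : (((2 * 1).choose 1 : ℕ) : ℝ) / (4 : ℝ) ^ 1 *
        |(fwdDiff (1 : ℕ))^[1] (fun j : ℕ => shellLaw M.2.partner univ H (2 * r + 1 + 6) (2 * j + 1) x) 0| ≤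
      Γ * q ^ 1 * shellLaw M.2.partner univ H (2 * r + 1 + 6) 1 x + (4 / 3 : ℝ) ^ 1 * τ)
    (h₁ : (((2 * 1).choose 1 : ℕ) : ℝ) / (4 : ℝ) ^ 1 *
        |(fwdDiff (1 : ℕ))^[1] (fun j : ℕ => ∑ v ∈ reps M.2.partner (vAA M.2.partner univ H),
          shellLaw M.2.partner (univ \ {v, M.2.partner v}) H (2 * r + 3 + 2) (2 * j + 1) (x - 2)) 0| ≤
      Γ * q ^ 1 * (∑ v ∈ reps M.2.partner (vAA M.2.partner univ H),
          shellLaw M.2.partner (univ \ {v, M.2.partner v}) H (2 * r + 3 + 2) 1 (x - 2)) + (a : ℝ) * ((4 / 3 : ℝ) ^ 1 * τ)) :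
    |(∑ U ∈ ((shellIn M.2.partner (univ : Finset (Fin n)) (2 * r + 1 + 6) (1 + 2)).filter fun U => ((U ∩ H).card : ℤ) = x),
        (((((reps M.2.partner (vAA M.2.partner univ H)).filter fun v => v ∈ U ∧ M.2.partner v ∈ U).card : ℕ) : ℝ) - m)) /
        ((shellIn M.2.partner (univ : Finset (Fin n)) (2 * r + 1 + 6) (1 + 2)).card : ℝ)| ≤
      (a : ℝ) * shellLaw M.2.partner univ H (2 * r + 1 + 6) 1 x * (4 * Γ * q + (2 + 4 * Γ * q) / (2 * (r : ℝ) + 6)) +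
        16 * (a : ℝ) / 3 * τ := by
  have hn0 : (0 : ℝ) < n := by
    have h10 : (10 : ℝ) ≤ n := by exact_mod_cast (le_trans (by omega) hrn)
    linarith
  have ha0 : (0 : ℝ) ≤ a := Nat.cast_nonneg a
  have hT0 : (0 : ℝ) < 2 * (r : ℝ) + 6 := by positivity
  have hTn : 2 * (r : ℝ) + 6 + 2 ≤ n := by
    have : ((2 * r + 10 : ℕ) : ℝ) ≤ n := by exact_mod_cast hrn
    push_cast at this; linarith
  -- brick 133 at `k = 1`
  have h133 := abs_fwdDiff_iter_centredFirst_le M H (t₀ := 2 * r + 3 + 2) ⟨r + 3, by ring⟩ (x : ℤ) m (k := 1) le_rfl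
    (by omega) (by omega)
  have eT : (((2 * r + 3 + 2 : ℕ) : ℕ) : ℝ) + 1 = 2 * (r : ℝ) + 6 := by push_cast; ring
  have e21 : 2 * ((1 : ℕ) : ℝ) / (n : ℝ) = 2 / (n : ℝ) := by rw [Nat.cast_one, mul_one]
  rw [eT, e21, show 2 * r + 3 + 2 + 2 = 2 * r + 1 + 6 by ring] at h133
  simp only [Function.iterate_one, Nat.sub_self, Function.iterate_zero, id_eq, fwdDiff, zero_add, mul_one, mul_zero,
    Nat.reduceAdd] at h133
  rw [hcentre, sub_zero, ← shellIn_univ] at h133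
  -- the `k = 1` budgets
  have e : (((2 * 1).choose 1 : ℕ) : ℝ) / (4 : ℝ) ^ 1 = 1 / 2 := by norm_num
  rw [e, Function.iterate_one, fwdDiff] at h₀ h₁
  simp only [zero_add, mul_one, mul_zero, pow_one, Nat.reduceAdd] at h₀ h₁
  -- the level-`1` comparison `G₁(0) ≤ (n/(2r+6))·a·law₁`
  have hF1 := firstFactorial_eq M H (r := r) (by omega) (x : ℤ)
  have hF1le := firstFactorial_le M H ha (2 * r + 1 + 6) 1 (x : ℤ)
  rw [hF1] at hF1le
  have hG₁0 : 0 ≤ ∑ v ∈ reps M.2.partner (vAA M.2.partner univ H),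
      shellLaw M.2.partner (univ \ {v, M.2.partner v}) H (2 * r + 3 + 2) 1 (↑x - 2) :=
    sum_nonneg fun _ _ => shellLaw_nonneg (π := M.2.partner) _ _ _ _ _
  have hG₁ : |∑ v ∈ reps M.2.partner (vAA M.2.partner univ H),
      shellLaw M.2.partner (univ \ {v, M.2.partner v}) H (2 * r + 3 + 2) 1 (↑x - 2)| ≤
      (n : ℝ) / (2 * (r : ℝ) + 6) * ((a : ℝ) * shellLaw M.2.partner univ H (2 * r + 1 + 6) 1 ↑x) := by
    rw [abs_of_nonneg hG₁0, div_mul_eq_mul_div, le_div_iff₀ hT0]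
    calc (∑ v ∈ reps M.2.partner (vAA M.2.partner univ H),
          shellLaw M.2.partner (univ \ {v, M.2.partner v}) H (2 * r + 3 + 2) 1 (↑x - 2)) * (2 * (r : ℝ) + 6)
        = (n : ℝ) * ((2 * (r : ℝ) + 6) / (n : ℝ) * ∑ v ∈ reps M.2.partner (vAA M.2.partner univ H),
          shellLaw M.2.partner (univ \ {v, M.2.partner v}) H (2 * r + 3 + 2) 1 (↑x - 2)) := by
          field_simp
      _ ≤ (n : ℝ) * ((a : ℝ) * shellLaw M.2.partner univ H (2 * r + 1 + 6) 1 ↑x) :=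
          mul_le_mul_of_nonneg_left hF1le hn0.le
  have habsm : |m| ≤ (a : ℝ) := by rw [abs_of_nonneg hm0]; exact hma
  refine h133.trans ?_
  refine b3_bound_of hT0 hn0 hTn ha0 (abs_nonneg m) habsm hΓ hq hτ (shellLaw_nonneg (π := M.2.partner) _ _ _ _ _) hG₁ ?_ ?_
  · rw [abs_of_nonneg hG₁0]; linarith
  · linarith

end Summit.PneNP.PneNP.Theorems.ChebyshevTracialDesignGammaDirectionSecondMomentRelativeAtoms

end
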